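import Literature.AlgebraicGeometry.Motives.KugaSatake
import HarnessLib

/-!
# Functoriality of the Kuga–Satake construction: similarities, isometries and rescaling

Companion to `Motives/KugaSatake`. Source read verbatim: M. Varesco, *Hodge similarities,
algebraic classes, and Kuga–Satake varieties* [Varesco2023] (arXiv:2304.02519), §3,
materialised p. 12:

* Lemma 3.2: for a similarity `ψ : (V, q) → (V', q')` of multiplier `λ`, "The isomorphism of
  graded rings `ψ_⊗ : ⊗^{ev} V → ⊗^{ev} V'`, `v₁ ⊗ ⋯ ⊗ v_{2m} ↦ (1/λ)^m ψv₁ ⊗ ⋯ ⊗ ψv_{2m}`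
  induces an isomorphism `ψ_Cl : Cl⁺(V) ≅ Cl⁺(V')`" (proof: `ψ_⊗(v ⊗ v - q(v)) =
  (1/λ)(ψv ⊗ ψv - q'(ψv))`).
* Lemma 3.3: "The map `ψ_{Cl,ℝ} : Cl⁺(V)_ℝ → Cl⁺(V')_ℝ` is compatible with the natural complex
  structures on `Cl⁺(V)_ℝ` and `Cl⁺(V')_ℝ`" (for a Hodge similarity of polarized Hodge
  structures of K3 type; proof: `ψ(Jx) = J'ψ(x)` with `e'ᵢ = ψ_ℝ eᵢ/√λ`).

## Main results (all proved)

* `KugaSatake.evenMapOfSimilar q₁ q₂ f c hf : CliffordAlgebra.even q₁ →ₐ[R] CliffordAlgebra.even q₂`,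
  `v w ↦ c⁻¹ (f v)(f w)`, for a similarity of unit multiplier `c` over any commutative ring
  (Mathlib's universal property `CliffordAlgebra.even.lift`), with `comp`/`id`;
  `KugaSatake.evenEquivOfSimilar` for bijective similarities (Lemma 3.2) and the special case
  `KugaSatake.evenScaleEquiv q c : CliffordAlgebra.even q ≃ₐ[R] CliffordAlgebra.even (c • q)`
  (**rescaling the form does not change `C⁺`**; `c = -1` compares van Geemen's `C(Q)` with
  Huybrechts' `Cl(V, -Q)`).
* `HodgeStructure.mem_kugaSatakeF1_iff_mulVecC_mul_eq_zero`: `C^{1,0} = {x : (ω̄ω)·x = 0}` inside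
  the algebra `C⁺(Q)_ℂ` (an intrinsically even form of vG's `{x : Jx = -ix}`).
* `HodgeStructure.kugaSatakeMap Q Q' h20 h20' f c hf : Hom (kugaSatake H Q h20) (kugaSatake H' Q' h20')`:
  **a Hodge similarity (in particular a Hodge isometry, `c = 1`) of polarized weight-two Hodge
  structures with `h^{2,0} = 1` induces a morphism of the Kuga–Satake Hodge structures**
  (Lemma 3.3), bijective for bijective `f` (`evenEquivOfSimilar`).

## Not here

Kuga–Satake varieties and the isogeny `ψ_KS` (Varesco Prop. 3.1), de Rham–Betti versions (§3.2).
-/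

open scoped TensorProduct

noncomputable section

namespace Literature.AlgebraicGeometry.Motives

universe u

namespace HodgeStructure

namespace KugaSatake

/-! ### Similarities induce homomorphisms of even Clifford algebras (pure algebra) -/

section Ring

variable {R : Type*} [CommRing R]
variable {M₁ M₂ M₃ : Type*} [AddCommGroup M₁] [Module R M₁] [AddCommGroup M₂] [Module R M₂]
  [AddCommGroup M₃] [Module R M₃]
variable (q₁ : QuadraticForm R M₁) (q₂ : QuadraticForm R M₂) (q₃ : QuadraticForm R M₃)

/-- The even-Clifford datum of a similarity `f : (M₁, q₁) → (M₂, q₂)` of unit multiplier `c`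
(`q₂(f v) = c · q₁(v)`): `(v, w) ↦ c⁻¹ ι(f v) ι(f w)` satisfies the relations of `C⁺(q₁)`
(Varesco, Lemma 3.2: `v₁ ⊗ ⋯ ⊗ v_{2m} ↦ (1/λ)^m ψv₁ ⊗ ⋯ ⊗ ψv_{2m}` "induces an isomorphism
`ψ_Cl : Cl⁺(V) ≅ Cl⁺(V')`"). [cite: Varesco2023, Lemma 3.2] -/
def similarEvenHom (f : M₁ →ₗ[R] M₂) (c : Rˣ) (hf : ∀ v, q₂ (f v) = (c : R) * q₁ v) :
    CliffordAlgebra.EvenHom q₁ (CliffordAlgebra.even q₂) where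
  bilin := ((c⁻¹ : Rˣ) : R) • (CliffordAlgebra.even.ι q₂).bilin.compl₁₂ f f
  contract m := by
    simp only [LinearMap.smul_apply, LinearMap.compl₁₂_apply, (CliffordAlgebra.even.ι q₂).contract,
      hf]
    rw [Algebra.smul_def, ← map_mul, ← mul_assoc, Units.inv_mul, one_mul]
  contract_mid m₁ m₂ m₃ := by
    simp only [LinearMap.smul_apply, LinearMap.compl₁₂_apply]
    rw [smul_mul_assoc, mul_smul_comm, smul_smul, (CliffordAlgebra.even.ι q₂).contract_mid, hf,
      smul_smul, smul_smul]
    congr 1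
    rw [show ((c⁻¹ : Rˣ) : R) * (c⁻¹ : Rˣ) * ((c : R) * q₁ m₂) =
      (c⁻¹ : Rˣ) * (((c⁻¹ : Rˣ) : R) * c) * q₁ m₂ by ring, Units.inv_mul, mul_one, mul_comm]

/-- **The homomorphism of even Clifford algebras induced by a similarity** of unit multiplier
`c`, `C⁺(q₁) → C⁺(q₂)`, `v w ↦ c⁻¹ (f v)(f w)` (Varesco, Lemma 3.2, `ψ_Cl`; for `c = 1` this is
the classical functoriality of `C⁺` under isometries, the even part of Mathlib's
`CliffordAlgebra.map`). [cite: Varesco2023, Lemma 3.2] -/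
def evenMapOfSimilar (f : M₁ →ₗ[R] M₂) (c : Rˣ) (hf : ∀ v, q₂ (f v) = (c : R) * q₁ v) :
    CliffordAlgebra.even q₁ →ₐ[R] CliffordAlgebra.even q₂ :=
  CliffordAlgebra.even.lift q₁ (similarEvenHom q₁ q₂ f c hf)

/-- `ψ_Cl(v w) = c⁻¹ (f v)(f w)`. [cite: Varesco2023, Lemma 3.2] -/
@[simp]
theorem evenMapOfSimilar_ι_bilin (f : M₁ →ₗ[R] M₂) (c : Rˣ)
    (hf : ∀ v, q₂ (f v) = (c : R) * q₁ v) (v w : M₁) :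
    evenMapOfSimilar q₁ q₂ f c hf ((CliffordAlgebra.even.ι q₁).bilin v w) =
      ((c⁻¹ : Rˣ) : R) • (CliffordAlgebra.even.ι q₂).bilin (f v) (f w) := by
  rw [evenMapOfSimilar, CliffordAlgebra.even.lift_ι]
  rfl

/-- Functoriality: `ψ_Cl` of a composite of similarities (multipliers multiply).
[cite: Varesco2023, Lemma 3.2] -/
theorem evenMapOfSimilar_comp (f : M₁ →ₗ[R] M₂) (g : M₂ →ₗ[R] M₃) (c d : Rˣ)
    (hf : ∀ v, q₂ (f v) = (c : R) * q₁ v) (hg : ∀ v, q₃ (g v) = (d : R) * q₂ v)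
    (hgf : ∀ v, q₃ ((g ∘ₗ f) v) = ((d * c : Rˣ) : R) * q₁ v) :
    (evenMapOfSimilar q₂ q₃ g d hg).comp (evenMapOfSimilar q₁ q₂ f c hf) =
      evenMapOfSimilar q₁ q₃ (g ∘ₗ f) (d * c) hgf := by
  ext v w
  simp only [CliffordAlgebra.EvenHom.compr₂_bilin, LinearMap.compr₂_apply, AlgHom.toLinearMap_apply,
    AlgHom.coe_comp, Function.comp_apply, evenMapOfSimilar_ι_bilin, map_smul, LinearMap.coe_comp,
    smul_smul, mul_inv_rev, Units.val_mul]

/-- `ψ_Cl` of the identity isometry is the identity. [cite: Varesco2023, Lemma 3.2] -/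
theorem evenMapOfSimilar_id (hid : ∀ v, q₁ (LinearMap.id (R := R) v) = ((1 : Rˣ) : R) * q₁ v) :
    evenMapOfSimilar q₁ q₁ LinearMap.id 1 hid = AlgHom.id R _ := by
  ext v w
  simp

/-- The inverse of a bijective similarity of unit multiplier `c` is a similarity of multiplier
`c⁻¹`. [folklore] -/
theorem similar_symm (e : M₁ ≃ₗ[R] M₂) (c : Rˣ) (he : ∀ v, q₂ (e v) = (c : R) * q₁ v) (w : M₂) :
    q₁ (e.symm w) = ((c⁻¹ : Rˣ) : R) * q₂ w := by
  have h := he (e.symm w)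
  rw [e.apply_symm_apply] at h
  rw [h, ← mul_assoc, Units.inv_mul, one_mul]

/-- **A bijective similarity induces an isomorphism of even Clifford algebras**
`C⁺(q₁) ≃ C⁺(q₂)` (Varesco, Lemma 3.2: "induces an isomorphism `ψ_Cl : Cl⁺(V) ≅ Cl⁺(V')`").
[cite: Varesco2023, Lemma 3.2] -/
def evenEquivOfSimilar (e : M₁ ≃ₗ[R] M₂) (c : Rˣ) (he : ∀ v, q₂ (e v) = (c : R) * q₁ v) :
    CliffordAlgebra.even q₁ ≃ₐ[R] CliffordAlgebra.even q₂ :=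
  AlgEquiv.ofAlgHom (evenMapOfSimilar q₁ q₂ e.toLinearMap c he)
    (evenMapOfSimilar q₂ q₁ e.symm.toLinearMap c⁻¹ (similar_symm q₁ q₂ e c he))
    (by
      rw [evenMapOfSimilar_comp q₂ q₁ q₂ _ _ _ _ _ _ (fun v => by simp), ← evenMapOfSimilar_id q₂]
      · congr 1 <;> simp
      · simp)
    (by
      rw [evenMapOfSimilar_comp q₁ q₂ q₁ _ _ _ _ _ _ (fun v => by simp), ← evenMapOfSimilar_id q₁]
      · congr 1 <;> simp
      · simp)

/-- The isomorphism of a bijective similarity is its `ψ_Cl`. [folklore] -/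
@[simp]
theorem coe_evenEquivOfSimilar (e : M₁ ≃ₗ[R] M₂) (c : Rˣ) (he : ∀ v, q₂ (e v) = (c : R) * q₁ v) :
    (evenEquivOfSimilar q₁ q₂ e c he : CliffordAlgebra.even q₁ →ₐ[R] CliffordAlgebra.even q₂) =
      evenMapOfSimilar q₁ q₂ e.toLinearMap c he :=
  rfl

/-- **Rescaling the quadratic form does not change the even Clifford algebra**:
`C⁺(q) ≃ₐ C⁺(c · q)` for every unit `c`, `v w ↦ c⁻¹ v w` (Varesco, Lemma 3.2 with `ψ = id`,
multiplier `c`; for `c = -1` this identifies van Geemen's `C⁺(Q)` with Huybrechts'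
`Cl⁺(V, q)`, `q = -Q`). [cite: Varesco2023, Lemma 3.2] -/
def evenScaleEquiv (c : Rˣ) :
    CliffordAlgebra.even q₁ ≃ₐ[R] CliffordAlgebra.even ((c : R) • q₁) :=
  evenEquivOfSimilar q₁ ((c : R) • q₁) (LinearEquiv.refl R M₁) c
    (fun v => by rw [QuadraticMap.smul_apply, smul_eq_mul]; rfl)

/-- `evenScaleEquiv c (v w) = c⁻¹ (v w)`. [cite: Varesco2023, Lemma 3.2] -/
theorem evenScaleEquiv_ι_bilin (c : Rˣ) (v w : M₁) :
    evenScaleEquiv q₁ c ((CliffordAlgebra.even.ι q₁).bilin v w) =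
      ((c⁻¹ : Rˣ) : R) • (CliffordAlgebra.even.ι ((c : R) • q₁)).bilin v w := by
  rw [evenScaleEquiv, evenEquivOfSimilar]
  exact evenMapOfSimilar_ι_bilin q₁ _ _ c _ v w

end Ring

/-! ### Complexification of `ψ_Cl` -/

variable {V₁ V₂ : Type u} [AddCommGroup V₁] [Module ℚ V₁] [AddCommGroup V₂] [Module ℚ V₂]
variable (q₁ : QuadraticForm ℚ V₁) (q₂ : QuadraticForm ℚ V₂)

/-- The complexification of an algebra map `φ : A → B` of `ℚ`-algebras is multiplicative
(`φ_ℂ = id ⊗ φ`). [folklore] -/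
theorem baseChange_map_mul {A B : Type*} [Ring A] [Algebra ℚ A] [Ring B] [Algebra ℚ B]
    (φ : A →ₐ[ℚ] B) (x y : ℂ ⊗[ℚ] A) :
    φ.toLinearMap.baseChange ℂ (x * y) =
      φ.toLinearMap.baseChange ℂ x * φ.toLinearMap.baseChange ℂ y := by
  have h : ∀ z, φ.toLinearMap.baseChange ℂ z = Algebra.TensorProduct.map (AlgHom.id ℂ ℂ) φ z := by
    intro z
    induction z using TensorProduct.induction_on with
    | zero => simp
    | tmul a b => simp
    | add z₁ z₂ h₁ h₂ => simp only [map_add, h₁, h₂]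
  rw [h, h, h, map_mul]

/-- `(ψ_Cl)_ℂ (θ η) = c⁻¹ (f_ℂ θ)(f_ℂ η)` for complex vectors `θ, η ∈ V₁ ⊗ ℂ`.
[cite: Varesco2023, Lemma 3.2] -/
theorem baseChange_evenMapOfSimilar_mulVecC (f : V₁ →ₗ[ℚ] V₂) (c : ℚˣ)
    (hf : ∀ v, q₂ (f v) = (c : ℚ) * q₁ v) (θ η : ℂ ⊗[ℚ] V₁) :
    (evenMapOfSimilar q₁ q₂ f c hf).toLinearMap.baseChange ℂ (mulVecC q₁ θ η) =
      ((c⁻¹ : ℚˣ) : ℚ) • mulVecC q₂ (f.baseChange ℂ θ) (f.baseChange ℂ η) := by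
  induction θ using TensorProduct.induction_on with
  | zero => simp
  | tmul a v =>
    induction η using TensorProduct.induction_on with
    | zero => simp
    | tmul b w => simp [TensorProduct.tmul_smul]
    | add x y hx hy => simp only [map_add, hx, hy, smul_add]
  | add x y hx hy => simp only [map_add, LinearMap.add_apply, hx, hy, smul_add]

end KugaSatake

/-! ### Functoriality of the Kuga–Satake Hodge structure under Hodge similarities -/

section K3

open KugaSatake

variable {V : Type u} [AddCommGroup V] [Module ℚ V]
variable {H : HodgeStructure V 2} (Q : H.Polarization)

/-- **`C⁺(Q)^{1,0}` inside `C⁺(Q)_ℂ`, intrinsically**: for a generator `ω` of `V^{2,0}` and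
`η = ω̄`, `x ∈ C^{1,0} ⇔ (η ω) · x = 0` in the algebra `C⁺(Q)_ℂ` (from `ω² = 0` and
`ωη + ηω = c ≠ 0`: `ωx = 0 ⇒ ηωx = 0`, and `ηωx = 0 ⇒ c ωx = ω(ηω x) + η ω² x = 0`). This form of
vG's `{x : Jx = -ix}` makes sense for maps defined only on even Clifford algebras.
[cite: vanGeemen2000KugaSatakeHC, §5.6] -/
theorem mem_kugaSatakeF1_iff_mulVecC_mul_eq_zero (h20 : H.hodgeNumber 2 0 = 1) {ω : ℂ ⊗[ℚ] V}
    (hω : ω ∈ H.piece 2 0) (hω0 : ω ≠ 0) {x : ℂ ⊗[ℚ] CliffordAlgebra.even Q.quadraticForm} :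
    x ∈ kugaSatakeF1 H Q ↔ mulVecC Q.quadraticForm (conj ω) ω * x = 0 := by
  rw [mem_kugaSatakeF1_iff_of_ne_zero H Q h20 hω hω0]
  set a := iotaC Q.quadraticForm ω with ha
  set b := iotaC Q.quadraticForm (conj ω) with hb
  set c : ℂ := 2 * Q.form.baseChange ℂ ω (conj ω) with hc_def
  have hc : c ≠ 0 := mul_ne_zero two_ne_zero (Q.form_conj_ne_zero (by norm_num) hω hω0)
  have haa : a * a = 0 := by
    have h2 := Q.iotaC_mul_iotaC_add_swap H ω ω
    rw [Q.form_baseChange_eq_zero_of_mem_piece_two_zero H hω hω, mul_zero, map_zero,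
      ← two_smul ℂ] at h2
    exact (smul_eq_zero.1 h2).resolve_left two_ne_zero
  have hab : a * b + b * a = algebraMap ℂ _ c := Q.iotaC_mul_iotaC_add_swap H ω (conj ω)
  constructor
  · intro h
    apply evenInclC_injective Q.quadraticForm
    rw [map_mul, evenInclC_mulVecC, map_zero, mul_assoc, h, mul_zero]
  · intro h
    have h' := congrArg (evenInclC Q.quadraticForm) h
    rw [map_mul, evenInclC_mulVecC, map_zero, mul_assoc] at h'
    have key : algebraMap ℂ _ c * (a * evenInclC Q.quadraticForm x) = 0 := by
      rw [← hab, add_mul, mul_assoc, h', mul_zero, zero_add, mul_assoc, ← mul_assoc a a, haa,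
        zero_mul, mul_zero]
    rw [← Algebra.smul_def, smul_eq_zero] at key
    exact key.resolve_left hc

variable {V' : Type u} [AddCommGroup V'] [Module ℚ V'] {H' : HodgeStructure V' 2}
  (Q' : H'.Polarization)

/-- A similarity of the quadratic forms of two weight-two polarizations is a similarity of the
bilinear forms: `Q'(f v, f w) = c Q(v, w)` (polarization identity, the forms being symmetric).
[folklore] -/
theorem Polarization.form_apply_apply_of_similar (f : V →ₗ[ℚ] V') (c : ℚ)
    (hf : ∀ v, Q'.quadraticForm (f v) = c * Q.quadraticForm v) (v w : V) :
    Q'.form (f v) (f w) = c * Q.form v w := by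
  have h2 : QuadraticMap.polar Q'.quadraticForm (f v) (f w) =
      c * QuadraticMap.polar Q.quadraticForm v w := by
    simp only [QuadraticMap.polar, ← map_add, hf]
    ring
  rw [LinearMap.BilinMap.polar_toQuadraticMap, LinearMap.BilinMap.polar_toQuadraticMap,
    Q'.form_comm (f v) (f w), Q.form_comm v w, ← two_mul, ← two_mul] at h2
  linarith

/-- A similarity with unit multiplier out of a polarized Hodge structure is injective
(`Q` is non-degenerate, `Polarization.nondegenerate`). [folklore] -/
theorem Polarization.injective_of_similar (f : V →ₗ[ℚ] V') (c : ℚˣ)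
    (hf : ∀ v, Q'.quadraticForm (f v) = (c : ℚ) * Q.quadraticForm v) : Function.Injective f := by
  rw [injective_iff_map_eq_zero]
  intro v hv
  refine Q.nondegenerate.1 v fun w => ?_
  have h := Q.form_apply_apply_of_similar Q' f c hf v w
  rw [hv, LinearMap.map_zero, LinearMap.zero_apply] at h
  exact (mul_eq_zero.1 h.symm).resolve_left c.ne_zero

/-- **Functoriality of the Kuga–Satake construction under Hodge similarities**: a morphism of
Hodge structures `f : (V, H) → (V', H')` which is a similarity of unit multiplier `c` for the
polarizations (`Q'(f v, f v) = c Q(v, v)`; `c = 1`: a Hodge isometry) induces the morphism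
`ψ_Cl : C⁺(Q) → C⁺(Q')` of the Kuga–Satake Hodge structures (Varesco, Lemma 3.3:
"`ψ_{Cl,ℝ} : Cl⁺(V)_ℝ → Cl⁺(V')_ℝ` is compatible with the natural complex structures", there
via `ψ(Jx) = J'ψ(x)`; here: `f_ℂ` maps a generator `ω` of `V^{2,0}` to a generator of `V'^{2,0}`,
and `ψ_ℂ((ω̄ω)x) = c⁻¹ (f ω̄ · f ω) ψ_ℂ(x)`, so `ψ_ℂ(C^{1,0}) ⊆ C'^{1,0}` by
`mem_kugaSatakeF1_iff_mulVecC_mul_eq_zero`). When `f` is bijective, `ψ_Cl` is bijective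
(`KugaSatake.evenEquivOfSimilar`). [cite: Varesco2023, Lemma 3.3] -/
def kugaSatakeMap (h20 : H.hodgeNumber 2 0 = 1) (h20' : H'.hodgeNumber 2 0 = 1) (f : Hom H H')
    (c : ℚˣ) (hf : ∀ v, Q'.quadraticForm (f.toLinearMap v) = (c : ℚ) * Q.quadraticForm v) :
    Hom (kugaSatake H Q h20) (kugaSatake H' Q' h20') where
  toLinearMap := (evenMapOfSimilar Q.quadraticForm Q'.quadraticForm f.toLinearMap c hf).toLinearMap
  map_F_le p := by
    rintro _ ⟨x, hx, rfl⟩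
    rw [SetLike.mem_coe, kugaSatake_F] at hx
    rw [kugaSatake_F]
    rcases le_or_gt p 0 with hp | hp
    · rw [kugaSatakeFiltration_of_nonpos H' Q' hp]
      exact Submodule.mem_top
    rcases le_or_gt 2 p with hp2 | hp2
    · rw [kugaSatakeFiltration_of_two_le H Q hp2, Submodule.mem_bot] at hx
      rw [hx, map_zero]
      exact Submodule.zero_mem _
    obtain rfl : p = 1 := by omega
    rw [kugaSatakeFiltration_one] at hx ⊢
    -- a generator `ω` of `V^{2,0}` is mapped to a generator `f_ℂ ω` of `V'^{2,0}`
    obtain ⟨ω, hω, hω0, -⟩ := exists_generator_piece_two_zero H h20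
    have hfω : f.toLinearMap.baseChange ℂ ω ∈ H'.piece 2 0 := f.map_piece_le 2 0 ⟨ω, hω, rfl⟩
    have hfinj : Function.Injective (f.toLinearMap.baseChange ℂ) := by
      rw [LinearMap.baseChange_eq_ltensor]
      exact Module.Flat.lTensor_preserves_injective_linearMap _
        (Q.injective_of_similar Q' f.toLinearMap c hf)
    have hfω0 : f.toLinearMap.baseChange ℂ ω ≠ 0 := fun h =>
      hω0 (hfinj (by rw [h, map_zero]))
    rw [mem_kugaSatakeF1_iff_mulVecC_mul_eq_zero Q h20 hω hω0] at hx
    rw [mem_kugaSatakeF1_iff_mulVecC_mul_eq_zero Q' h20' hfω hfω0, conj_baseChange]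
    have h := congrArg
      ((evenMapOfSimilar Q.quadraticForm Q'.quadraticForm f.toLinearMap c hf).toLinearMap.baseChange ℂ)
      hx
    rw [map_zero, baseChange_map_mul, baseChange_evenMapOfSimilar_mulVecC, smul_mul_assoc,
      smul_eq_zero] at h
    exact h.resolve_left (Units.ne_zero _)

/-- The underlying linear map of `kugaSatakeMap` is `ψ_Cl`. [folklore] -/
@[simp]
theorem kugaSatakeMap_toLinearMap (h20 : H.hodgeNumber 2 0 = 1) (h20' : H'.hodgeNumber 2 0 = 1)
    (f : Hom H H') (c : ℚˣ)
    (hf : ∀ v, Q'.quadraticForm (f.toLinearMap v) = (c : ℚ) * Q.quadraticForm v) :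
    (kugaSatakeMap Q Q' h20 h20' f c hf).toLinearMap =
      (evenMapOfSimilar Q.quadraticForm Q'.quadraticForm f.toLinearMap c hf).toLinearMap :=
  rfl

end K3

end HodgeStructure

end Literature.AlgebraicGeometry.Motives

end
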